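import Summits.Ventures.CertifiedManyBodySolver.Certificates.HubbardSquare_boxword_La214E_xlVarboxColumns
import HarnessLib

/-!
# Ventures/CertifiedManyBodySolver — Certificates/HubbardSquare_boxword_cuprateFamily_xl_devices.lean (hubbard-box-eng-4 g5, cell hubbard-algo)

HONEST FRAMING: transport bookkeeping of certified ground-state-energy bounds; not a superconductivity verdict; not a pairing
bound; nothing is asserted unconditionally — every device below is «certificates (by hypothesis) ⇒ bound».

**GENERIC DEVICES FOR THE CUPRATE-FAMILY BOX WORDS (TRANCHE-2 XL CORNERS).** The validation-set object-E boxes of the material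
oracle (surrogate-1 materials v0.10: Hg1201 M19/M19b `t'/t ∈ [−0.54,−0.43]`, infinite-layer nickelates M21/M22/M59/M60/M39a/M39b
`[−0.47,−0.33]`, CCOC M36/M57 `[−0.41,−0.27]`, La-214 M14–M17 `[−0.30,−0.20]`) are read through ANCHOR RECTANGLES of the `(t', U)`
half-plane whose four corners carry XL-class (EXT5-L⁺(t′) program, u′ su2avg) lower certificates in TANGENT form
`a_v + b_v·n ≤ e₀(1, t'_v, U_v, n)` (weak duality with the density-row right-hand side free, hence valid at every filling), exactly as
the box-#1 modules `HubbardSquare_n7o8_boxword_cuprate_xl{,_nwide}` and `HubbardSquare_boxword_La214E_xlVarboxColumns` do for the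
rectangle `[−3/10,−1/5] × [15/2,17/2]`:

* `cfxl_floor_of` — rectangle tangents ⊕ joint concavity of `e₀` in `(t',U)` (`energyDensityTT'_box_ge_min`) ⊕ monotonicity in `U`
  (`energyDensityTT'_mono_U`): a literal below the four tangents at the slab's lower filling floors the whole half-strip
  `t' ∈ [s₁,s₂]`, `U ≥ U₁`, `n ∈ [nlo,nhi]` (slopes `b_v ≥ 0`, so the binding filling is `nlo`).
* `cfxl_floor_sub_of` — the cell-resolved form: bilinear interpolation of the four corner values (`energyDensityTT'_box_ge`) at the
  corners of a sub-rectangle `[σ₁,σ₂] × [V₁,V₂]`, then `energyDensityTT'_box_ge_min` on the sub-rectangle and `U`-monotonicity beyond `V₂`.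
* `cfxl_face78_cap_of` — the hubbard-fast VARBOX plane `hVB` (REFEREED CAP PLANE, sr-mbsolver-ref-6 R6.68 2026-08-27; state
  `hub_openboxTT_32x4_U8_tpm1o4_N56-56_D1200_b2`; a fixed open-box state's energy is affine in `(t',U)`, so the plane caps
  `e₀(1,t',U,7/8)` at every `U ≥ 0` and every real `t'`) evaluated at a box corner `(thi ≤ 0, Uhi)`; `cfxl_cap_below_of` /
  `cfxl_cap_above_of` / `cfxl_cap_straddle_of` — the density chords (`e₀` convex in `n`: vacuum chord below `7/8`, chord to a half-filling
  cap above) with the face cap `S` and the half-filling cap `C` symbolic (the La-214 module's `la214xl_halfFilling_cap_of` supplies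
  `C = #469` for `U ≤ 16`).

The per-family word files (`…_cuprateFamily_xl_<family>.lean`) instantiate these with the corner literals of hubbard-box-eng-4
`tables/xl_corners.json` (box #1, reader side complete) and `tables/xl_corners_t2.json` (tranche 2, producer-certified until the
mbsolver desk signs). WHAT THIS IS NOT: a phase word; a new bound at any anchor; the VARBOX plane is a refereed cap plane, not a
registry row; off-design (`t' < −0.3`) the plane is honest but loose — a design state there is the named lever (VAR crew).
-/

noncomputable section

namespace Summit.Ventures.CertifiedManyBodySolver.Certificates

open Literature.MathematicalPhysics.QuantumLattice
open Literature.MathematicalPhysics.QuantumLattice.ThermodynamicLimit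

/-- Tangent monotonicity: a floor `a + b·n ≤ e` with `b ≥ 0` and `nlo ≤ n` gives `a + b·nlo ≤ e`. [cite: Israel1979, Thm. I.3.4] -/
theorem cfxl_tangent_at_lo {a b nlo n e : ℝ} (hb : 0 ≤ b) (hl : nlo ≤ n) (h : a + b * n ≤ e) : a + b * nlo ≤ e := by
  have hm : b * nlo ≤ b * n := mul_le_mul_of_nonneg_left hl hb
  linarith

/-- **FLOOR device (generic anchor rectangle, tangent form, `U`-monotone extension).** Four XL corner certificates in
tangent form `a_v + b_v·n ≤ e₀(1, s_v, U_v, n)` on a filling slab `[nlo, nhi]` at the corners of the anchor rectangle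
`[s₁, s₂] × [U₁, U₂]` of the `(t', U)` half-plane, with nonnegative slopes and a common literal `L` below every tangent at
`nlo`, floor `e₀(1, t', U, n)` by `L` for every `t' ∈ [s₁, s₂]`, every `U ≥ U₁` and every `n ∈ [nlo, nhi]` (joint concavity in
`(t', U)` on the rectangle, then monotonicity in `U` from the clipped coupling `min U U₂`). [cite: Israel1979, Thm. I.3.4] -/
theorem cfxl_floor_of {s₁ s₂ U₁ U₂ a₁₁ b₁₁ a₁₂ b₁₂ a₂₁ b₂₁ a₂₂ b₂₂ nlo nhi L : ℝ}
    (hnlo : 0 ≤ nlo) (hnhi : nhi < 2) (hU₁ : 0 ≤ U₁) (hs : s₁ < s₂) (hU : U₁ < U₂)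
    (hX₁₁ : ∀ n ∈ Set.Icc nlo nhi, a₁₁ + b₁₁ * n ≤ energyDensityTT' 1 s₁ U₁ n)
    (hX₁₂ : ∀ n ∈ Set.Icc nlo nhi, a₁₂ + b₁₂ * n ≤ energyDensityTT' 1 s₁ U₂ n)
    (hX₂₁ : ∀ n ∈ Set.Icc nlo nhi, a₂₁ + b₂₁ * n ≤ energyDensityTT' 1 s₂ U₁ n)
    (hX₂₂ : ∀ n ∈ Set.Icc nlo nhi, a₂₂ + b₂₂ * n ≤ energyDensityTT' 1 s₂ U₂ n)
    (hb₁₁ : 0 ≤ b₁₁) (hb₁₂ : 0 ≤ b₁₂) (hb₂₁ : 0 ≤ b₂₁) (hb₂₂ : 0 ≤ b₂₂)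
    (hL₁₁ : L ≤ a₁₁ + b₁₁ * nlo) (hL₁₂ : L ≤ a₁₂ + b₁₂ * nlo)
    (hL₂₁ : L ≤ a₂₁ + b₂₁ * nlo) (hL₂₂ : L ≤ a₂₂ + b₂₂ * nlo)
    {U t' n : ℝ} (hU₁' : U₁ ≤ U) (ht₁ : s₁ ≤ t') (ht₂ : t' ≤ s₂) (hn : n ∈ Set.Icc nlo nhi) :
    L ≤ energyDensityTT' 1 t' U n := by
  have hn0 : (0 : ℝ) ≤ n := hnlo.trans hn.1
  have hn2 : n < (2 : ℝ) := lt_of_le_of_lt hn.2 hnhi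
  have hl : nlo ≤ n := hn.1
  have e₁₁ : L ≤ energyDensityTT' 1 s₁ U₁ n := hL₁₁.trans (cfxl_tangent_at_lo hb₁₁ hl (hX₁₁ n hn))
  have e₁₂ : L ≤ energyDensityTT' 1 s₁ U₂ n := hL₁₂.trans (cfxl_tangent_at_lo hb₁₂ hl (hX₁₂ n hn))
  have e₂₁ : L ≤ energyDensityTT' 1 s₂ U₁ n := hL₂₁.trans (cfxl_tangent_at_lo hb₂₁ hl (hX₂₁ n hn))
  have e₂₂ : L ≤ energyDensityTT' 1 s₂ U₂ n := hL₂₂.trans (cfxl_tangent_at_lo hb₂₂ hl (hX₂₂ n hn))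
  have hbox : ∀ {V : ℝ}, U₁ ≤ V → V ≤ U₂ → L ≤ energyDensityTT' 1 t' V n := by
    intro V hV₁ hV₂
    have hb := energyDensityTT'_box_ge_min 1 (n := n) hn0 hn2
      (s₁ := s₁) (s₂ := s₂) (U₁ := U₁) (U₂ := U₂) (s := t') (U := V)
      hU₁ hs hU ht₁ ht₂ hV₁ hV₂ e₁₁ e₁₂ e₂₁ e₂₂
    simpa only [min_self] using hb
  rcases le_total U U₂ with hU' | hU'
  · exact hbox hU₁' hU'
  · have hU₂0 : (0 : ℝ) ≤ U₂ := hU₁.trans hU.le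
    have hm : energyDensityTT' 1 t' U₂ n ≤ energyDensityTT' 1 t' U n :=
      energyDensityTT'_mono_U 1 t' (n := n) hn0 hn2 hU₂0 hU'
    exact (hbox hU.le le_rfl).trans hm

/-- **FLOOR device, SUB-RECTANGLE form (cell-resolved words).** Same anchor rectangle and tangents as `cfxl_floor_of`; for a
sub-rectangle `[σ₁, σ₂] × [V₁, V₂] ⊆ [s₁, s₂] × [U₁, U₂]` and a literal `L` below the bilinear interpolant of the four corner values
`F_v = a_v + b_v·nlo` at each of the four sub-rectangle corners (`L·den ≤ Bil(σ_i, V_j)`, `den = (s₂−s₁)(U₂−U₁)`), `L` floors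
`e₀(1, t', U, n)` for every `t' ∈ [σ₁, σ₂]`, every `U ≥ V₁` (clipped at `V₂`, then `U`-monotone) and every `n ∈ [nlo, nhi]`.
[cite: Israel1979, Thm. I.3.4] -/
theorem cfxl_floor_sub_of {s₁ s₂ U₁ U₂ a₁₁ b₁₁ a₁₂ b₁₂ a₂₁ b₂₁ a₂₂ b₂₂ nlo nhi : ℝ}
    (hnlo : 0 ≤ nlo) (hnhi : nhi < 2) (hU₁ : 0 ≤ U₁) (hs : s₁ < s₂) (hU : U₁ < U₂)
    (hX₁₁ : ∀ n ∈ Set.Icc nlo nhi, a₁₁ + b₁₁ * n ≤ energyDensityTT' 1 s₁ U₁ n)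
    (hX₁₂ : ∀ n ∈ Set.Icc nlo nhi, a₁₂ + b₁₂ * n ≤ energyDensityTT' 1 s₁ U₂ n)
    (hX₂₁ : ∀ n ∈ Set.Icc nlo nhi, a₂₁ + b₂₁ * n ≤ energyDensityTT' 1 s₂ U₁ n)
    (hX₂₂ : ∀ n ∈ Set.Icc nlo nhi, a₂₂ + b₂₂ * n ≤ energyDensityTT' 1 s₂ U₂ n)
    (hb₁₁ : 0 ≤ b₁₁) (hb₁₂ : 0 ≤ b₁₂) (hb₂₁ : 0 ≤ b₂₁) (hb₂₂ : 0 ≤ b₂₂)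
    {σ₁ σ₂ V₁ V₂ L : ℝ} (hσ₁ : s₁ ≤ σ₁) (hσ : σ₁ < σ₂) (hσ₂ : σ₂ ≤ s₂) (hV₁ : U₁ ≤ V₁) (hV : V₁ < V₂) (hV₂ : V₂ ≤ U₂)
    (hP₁₁ : L * ((s₂ - s₁) * (U₂ - U₁)) ≤ (s₂ - σ₁) * ((U₂ - V₁) * (a₁₁ + b₁₁ * nlo) + (V₁ - U₁) * (a₁₂ + b₁₂ * nlo)) +
        (σ₁ - s₁) * ((U₂ - V₁) * (a₂₁ + b₂₁ * nlo) + (V₁ - U₁) * (a₂₂ + b₂₂ * nlo)))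
    (hP₁₂ : L * ((s₂ - s₁) * (U₂ - U₁)) ≤ (s₂ - σ₁) * ((U₂ - V₂) * (a₁₁ + b₁₁ * nlo) + (V₂ - U₁) * (a₁₂ + b₁₂ * nlo)) +
        (σ₁ - s₁) * ((U₂ - V₂) * (a₂₁ + b₂₁ * nlo) + (V₂ - U₁) * (a₂₂ + b₂₂ * nlo)))
    (hP₂₁ : L * ((s₂ - s₁) * (U₂ - U₁)) ≤ (s₂ - σ₂) * ((U₂ - V₁) * (a₁₁ + b₁₁ * nlo) + (V₁ - U₁) * (a₁₂ + b₁₂ * nlo)) +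
        (σ₂ - s₁) * ((U₂ - V₁) * (a₂₁ + b₂₁ * nlo) + (V₁ - U₁) * (a₂₂ + b₂₂ * nlo)))
    (hP₂₂ : L * ((s₂ - s₁) * (U₂ - U₁)) ≤ (s₂ - σ₂) * ((U₂ - V₂) * (a₁₁ + b₁₁ * nlo) + (V₂ - U₁) * (a₁₂ + b₁₂ * nlo)) +
        (σ₂ - s₁) * ((U₂ - V₂) * (a₂₁ + b₂₁ * nlo) + (V₂ - U₁) * (a₂₂ + b₂₂ * nlo)))
    {U t' n : ℝ} (hV₁' : V₁ ≤ U) (ht₁ : σ₁ ≤ t') (ht₂ : t' ≤ σ₂) (hn : n ∈ Set.Icc nlo nhi) :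
    L ≤ energyDensityTT' 1 t' U n := by
  have hn0 : (0 : ℝ) ≤ n := hnlo.trans hn.1
  have hn2 : n < (2 : ℝ) := lt_of_le_of_lt hn.2 hnhi
  have hl : nlo ≤ n := hn.1
  have hden : 0 < (s₂ - s₁) * (U₂ - U₁) := mul_pos (sub_pos.2 hs) (sub_pos.2 hU)
  have e₁₁ : a₁₁ + b₁₁ * nlo ≤ energyDensityTT' 1 s₁ U₁ n := cfxl_tangent_at_lo hb₁₁ hl (hX₁₁ n hn)
  have e₁₂ : a₁₂ + b₁₂ * nlo ≤ energyDensityTT' 1 s₁ U₂ n := cfxl_tangent_at_lo hb₁₂ hl (hX₁₂ n hn)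
  have e₂₁ : a₂₁ + b₂₁ * nlo ≤ energyDensityTT' 1 s₂ U₁ n := cfxl_tangent_at_lo hb₂₁ hl (hX₂₁ n hn)
  have e₂₂ : a₂₂ + b₂₂ * nlo ≤ energyDensityTT' 1 s₂ U₂ n := cfxl_tangent_at_lo hb₂₂ hl (hX₂₂ n hn)
  -- point floors at the four sub-rectangle corners (bilinear interpolation on the anchor rectangle)
  have pt : ∀ {σ V : ℝ}, s₁ ≤ σ → σ ≤ s₂ → U₁ ≤ V → V ≤ U₂ →
      L * ((s₂ - s₁) * (U₂ - U₁)) ≤ (s₂ - σ) * ((U₂ - V) * (a₁₁ + b₁₁ * nlo) + (V - U₁) * (a₁₂ + b₁₂ * nlo)) +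
        (σ - s₁) * ((U₂ - V) * (a₂₁ + b₂₁ * nlo) + (V - U₁) * (a₂₂ + b₂₂ * nlo)) →
      L ≤ energyDensityTT' 1 σ V n := by
    intro σ V h₁ h₂ h₃ h₄ hP
    have hb := energyDensityTT'_box_ge 1 (n := n) hn0 hn2 (s₁ := s₁) (s₂ := s₂) (U₁ := U₁) (U₂ := U₂) (s := σ) (U := V)
      hU₁ hs hU h₁ h₂ h₃ h₄ e₁₁ e₁₂ e₂₁ e₂₂
    have hL : L ≤ ((s₂ - σ) * ((U₂ - V) * (a₁₁ + b₁₁ * nlo) + (V - U₁) * (a₁₂ + b₁₂ * nlo)) +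
        (σ - s₁) * ((U₂ - V) * (a₂₁ + b₂₁ * nlo) + (V - U₁) * (a₂₂ + b₂₂ * nlo))) / ((s₂ - s₁) * (U₂ - U₁)) := by
      rw [le_div_iff₀ hden]; exact hP
    exact hL.trans hb
  have c₁₁ := pt hσ₁ (hσ.le.trans hσ₂) hV₁ (hV.le.trans hV₂) hP₁₁
  have c₁₂ := pt hσ₁ (hσ.le.trans hσ₂) (hV₁.trans hV.le) hV₂ hP₁₂
  have c₂₁ := pt (hσ₁.trans hσ.le) hσ₂ hV₁ (hV.le.trans hV₂) hP₂₁
  have c₂₂ := pt (hσ₁.trans hσ.le) hσ₂ (hV₁.trans hV.le) hV₂ hP₂₂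
  have hV₁0 : 0 ≤ V₁ := hU₁.trans hV₁
  have hbox : ∀ {W : ℝ}, V₁ ≤ W → W ≤ V₂ → L ≤ energyDensityTT' 1 t' W n := by
    intro W hW₁ hW₂
    have hb := energyDensityTT'_box_ge_min 1 (n := n) hn0 hn2
      (s₁ := σ₁) (s₂ := σ₂) (U₁ := V₁) (U₂ := V₂) (s := t') (U := W)
      hV₁0 hσ hV ht₁ ht₂ hW₁ hW₂ c₁₁ c₁₂ c₂₁ c₂₂
    simpa only [min_self] using hb
  rcases le_total U V₂ with hU' | hU'
  · exact hbox hV₁' hU'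
  · have hV₂0 : (0 : ℝ) ≤ V₂ := hV₁0.trans hV.le
    have hm : energyDensityTT' 1 t' V₂ n ≤ energyDensityTT' 1 t' U n :=
      energyDensityTT'_mono_U 1 t' (n := n) hn0 hn2 hV₂0 hU'
    exact (hbox hV.le le_rfl).trans hm

/-- **CAP device, face `n = 7/8`, any box corner.** The hubbard-fast VARBOX plane `hVB` (REFEREED CAP PLANE, R6.68; state
`hub_openboxTT_32x4_U8_tpm1o4_N56-56_D1200_b2`; a fixed open-box state's energy is affine in `(t', U)`, so the plane caps
`e₀(1,t',U,7/8)` at EVERY `U ≥ 0` and every `t'`) evaluated at a box corner `(thi, Uhi)` with `thi ≤ 0`: for `0 ≤ U ≤ Uhi`,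
`t' ≤ thi`, `e₀(1,t',U,7/8) ≤ S` whenever `A + thi·B_lo + Uhi·D ≤ S` (`0 < B_lo ≤ B_hi`, `D > 0`).
[cite: BachLiebSolovej1994, eq. (2c.36)] -/
theorem cfxl_face78_cap_of
    (hVB : ∀ (t' U : ℝ), 0 ≤ U → energyDensityTT' 1 t' U (7/8) ≤
      (((-16636389046309/17592186044416 : ℚ)) : ℝ) + max (t' * (((258065076745/140737488355328 : ℚ)) : ℝ))
        (t' * (((129032539397/70368744177664 : ℚ)) : ℝ)) + U * (((4881487697691/140737488355328 : ℚ)) : ℝ))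
    {Uhi thi S : ℝ} (hthi : thi ≤ 0)
    (hS : (((-16636389046309/17592186044416 : ℚ)) : ℝ) + thi * (((258065076745/140737488355328 : ℚ)) : ℝ) +
      Uhi * (((4881487697691/140737488355328 : ℚ)) : ℝ) ≤ S)
    {U t' : ℝ} (hU0 : 0 ≤ U) (hU₂ : U ≤ Uhi) (ht₂ : t' ≤ thi) :
    energyDensityTT' 1 t' U (7/8) ≤ S := by
  have h := hVB t' U hU0
  have ht0 : t' ≤ 0 := ht₂.trans hthi
  have hB : max (t' * (((258065076745/140737488355328 : ℚ)) : ℝ)) (t' * (((129032539397/70368744177664 : ℚ)) : ℝ)) ≤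
      thi * (((258065076745/140737488355328 : ℚ)) : ℝ) := by
    refine max_le ?_ ?_ <;> push_cast <;> nlinarith
  have hD : U * (((4881487697691/140737488355328 : ℚ)) : ℝ) ≤ Uhi * (((4881487697691/140737488355328 : ℚ)) : ℝ) := by
    push_cast; nlinarith
  linarith

/-- **CAP on a filling slab BELOW `7/8`** (`0 < nlo ≤ n ≤ nhi ≤ 7/8`) from a face cap `e₀(1,t',U,7/8) ≤ S < 0`: vacuum chord
`e₀(n) ≤ (8n/7)·S`, worst at `nlo`. [cite: Ruelle1969, §3.3] -/
theorem cfxl_cap_below_of {S : ℝ} (hSneg : S < 0) {nlo nhi : ℝ} (hnlo : 0 < nlo) (hnhi : nhi ≤ 7/8)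
    {U t' n : ℝ} (hU0 : 0 ≤ U) (hS : energyDensityTT' 1 t' U (7/8) ≤ S) (hn : n ∈ Set.Icc nlo nhi) :
    energyDensityTT' 1 t' U n ≤ (8 * nlo / 7) * S := by
  rcases eq_or_lt_of_le (hn.1.trans (hn.2.trans hnhi)) with h78 | h78
  · have hn78 : n = 7/8 := le_antisymm (hn.2.trans hnhi) (by linarith [hn.1])
    rw [hn78]
    have : (8 * nlo / 7) * S = S := by rw [h78]; ring
    rw [this]; exact hS
  · have hlo := energyDensityTT'_le_vacuum_chord 1 t' hU0 (n := nlo) (n₂ := 7/8) hnlo h78 (by norm_num) hS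
    have hmax := energyDensityTT'_le_max_of_mem_Icc 1 t' hU0 (m₁ := nlo) (m₂ := 7/8) hnlo.le (by norm_num)
      hlo hS ⟨hn.1, hn.2.trans hnhi⟩
    refine hmax.trans (max_le ?_ ?_)
    · have : nlo / (7/8) * S = (8 * nlo / 7) * S := by ring
      rw [this]
    · have hfac : 8 * nlo / 7 ≤ 1 := by linarith
      nlinarith

/-- **CAP on a filling slab ABOVE `7/8`** (`7/8 ≤ nlo ≤ n ≤ nhi < 1`) from a face cap `e₀(1,t',U,7/8) ≤ S` and a half-filling cap
`e₀(1,t',U,1) ≤ C` with `S < C`: density chord `e₀(n) ≤ 8((1−n_hi)·S + (n_hi − 7/8)·C)`, worst at `nhi`. [cite: Ruelle1969, §3.3] -/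
theorem cfxl_cap_above_of {S C : ℝ} (hSC : S < C) {nlo nhi : ℝ} (hnlo : 7/8 ≤ nlo) (hnhi : nhi < 1)
    {U t' n : ℝ} (hU0 : 0 ≤ U) (hS : energyDensityTT' 1 t' U (7/8) ≤ S) (hC : energyDensityTT' 1 t' U 1 ≤ C)
    (hn : n ∈ Set.Icc nlo nhi) :
    energyDensityTT' 1 t' U n ≤ 8 * ((1 - nhi) * S + (nhi - 7/8) * C) := by
  rcases eq_or_lt_of_le (hnlo.trans (hn.1.trans hn.2)) with h78 | h78
  · have hn78 : n = 7/8 := le_antisymm (by linarith [hn.2]) (hnlo.trans hn.1)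
    rw [hn78]
    have : 8 * ((1 - nhi) * S + (nhi - 7/8) * C) = S := by rw [← h78]; ring
    rw [this]; exact hS
  · have hhi := energyDensityTT'_le_density_chord 1 t' hU0 (n₁ := 7/8) (n := nhi) (n₂ := 1)
      (by norm_num) h78 hnhi (by norm_num) hS hC
    have hmax := energyDensityTT'_le_max_of_mem_Icc 1 t' hU0 (m₁ := 7/8) (m₂ := nhi) (by norm_num) (by linarith)
      hS hhi ⟨hnlo.trans hn.1, hn.2⟩
    refine hmax.trans (max_le ?_ ?_)
    · nlinarith
    · have : ((1 - nhi) * S + (nhi - 7/8) * C) / (1 - 7/8) = 8 * ((1 - nhi) * S + (nhi - 7/8) * C) := by ring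
      exact le_of_eq this

/-- **CAP on a filling slab STRADDLING `7/8`** (`0 < nlo ≤ n ≤ nhi < 1`, any position of `7/8`): the larger of the two chord caps.
[cite: Ruelle1969, §3.3] -/
theorem cfxl_cap_straddle_of {S C : ℝ} (hSneg : S < 0) (hSC : S < C) {nlo nhi : ℝ} (hnlo : 0 < nlo) (hnhi : nhi < 1)
    {U t' n : ℝ} (hU0 : 0 ≤ U) (hS : energyDensityTT' 1 t' U (7/8) ≤ S) (hC : energyDensityTT' 1 t' U 1 ≤ C)
    (hn : n ∈ Set.Icc nlo nhi) :
    energyDensityTT' 1 t' U n ≤ max ((8 * nlo / 7) * S) (8 * ((1 - nhi) * S + (nhi - 7/8) * C)) := by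
  rcases le_total n (7/8) with h | h
  · exact (cfxl_cap_below_of hSneg hnlo le_rfl hU0 hS ⟨hn.1, h⟩).trans (le_max_left _ _)
  · exact (cfxl_cap_above_of hSC le_rfl hnhi hU0 hS hC ⟨h, hn.2⟩).trans (le_max_right _ _)

/-- Tangent at either end: an affine floor `a + b·n ≤ e` on `nlo ≤ n ≤ nhi` and a literal `L` below BOTH end values gives `L ≤ e`
(any sign of the slope `b`). [cite: Israel1979, Thm. I.3.4] -/
theorem cfxl_tangent_ends {a b nlo nhi n e L : ℝ} (hlo : nlo ≤ n) (hhi : n ≤ nhi) (h : a + b * n ≤ e)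
    (hL₁ : L ≤ a + b * nlo) (hL₂ : L ≤ a + b * nhi) : L ≤ e := by
  rcases le_total 0 b with hb | hb
  · have hm : b * nlo ≤ b * n := mul_le_mul_of_nonneg_left hlo hb
    linarith
  · have hm : b * nhi ≤ b * n := mul_le_mul_of_nonpos_left hhi hb
    linarith

/-- **FLOOR device, two-ended tangents (any slope sign).** As `cfxl_floor_of`, but the literal `L` is required below each corner
tangent at BOTH ends of the filling slab (so no sign hypothesis on the slopes is needed). [cite: Israel1979, Thm. I.3.4] -/
theorem cfxl_floor2_of {s₁ s₂ U₁ U₂ a₁₁ b₁₁ a₁₂ b₁₂ a₂₁ b₂₁ a₂₂ b₂₂ nlo nhi L : ℝ}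
    (hnlo : 0 ≤ nlo) (hnhi : nhi < 2) (hU₁ : 0 ≤ U₁) (hs : s₁ < s₂) (hU : U₁ < U₂)
    (hX₁₁ : ∀ n ∈ Set.Icc nlo nhi, a₁₁ + b₁₁ * n ≤ energyDensityTT' 1 s₁ U₁ n)
    (hX₁₂ : ∀ n ∈ Set.Icc nlo nhi, a₁₂ + b₁₂ * n ≤ energyDensityTT' 1 s₁ U₂ n)
    (hX₂₁ : ∀ n ∈ Set.Icc nlo nhi, a₂₁ + b₂₁ * n ≤ energyDensityTT' 1 s₂ U₁ n)
    (hX₂₂ : ∀ n ∈ Set.Icc nlo nhi, a₂₂ + b₂₂ * n ≤ energyDensityTT' 1 s₂ U₂ n)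
    (hL₁₁ : L ≤ a₁₁ + b₁₁ * nlo) (hL₁₁' : L ≤ a₁₁ + b₁₁ * nhi) (hL₁₂ : L ≤ a₁₂ + b₁₂ * nlo) (hL₁₂' : L ≤ a₁₂ + b₁₂ * nhi)
    (hL₂₁ : L ≤ a₂₁ + b₂₁ * nlo) (hL₂₁' : L ≤ a₂₁ + b₂₁ * nhi) (hL₂₂ : L ≤ a₂₂ + b₂₂ * nlo) (hL₂₂' : L ≤ a₂₂ + b₂₂ * nhi)
    {U t' n : ℝ} (hU₁' : U₁ ≤ U) (ht₁ : s₁ ≤ t') (ht₂ : t' ≤ s₂) (hn : n ∈ Set.Icc nlo nhi) :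
    L ≤ energyDensityTT' 1 t' U n := by
  have hn0 : (0 : ℝ) ≤ n := hnlo.trans hn.1
  have hn2 : n < (2 : ℝ) := lt_of_le_of_lt hn.2 hnhi
  have e₁₁ : L ≤ energyDensityTT' 1 s₁ U₁ n := cfxl_tangent_ends hn.1 hn.2 (hX₁₁ n hn) hL₁₁ hL₁₁'
  have e₁₂ : L ≤ energyDensityTT' 1 s₁ U₂ n := cfxl_tangent_ends hn.1 hn.2 (hX₁₂ n hn) hL₁₂ hL₁₂'
  have e₂₁ : L ≤ energyDensityTT' 1 s₂ U₁ n := cfxl_tangent_ends hn.1 hn.2 (hX₂₁ n hn) hL₂₁ hL₂₁'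
  have e₂₂ : L ≤ energyDensityTT' 1 s₂ U₂ n := cfxl_tangent_ends hn.1 hn.2 (hX₂₂ n hn) hL₂₂ hL₂₂'
  have hbox : ∀ {V : ℝ}, U₁ ≤ V → V ≤ U₂ → L ≤ energyDensityTT' 1 t' V n := by
    intro V hV₁ hV₂
    have hb := energyDensityTT'_box_ge_min 1 (n := n) hn0 hn2
      (s₁ := s₁) (s₂ := s₂) (U₁ := U₁) (U₂ := U₂) (s := t') (U := V)
      hU₁ hs hU ht₁ ht₂ hV₁ hV₂ e₁₁ e₁₂ e₂₁ e₂₂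
    simpa only [min_self] using hb
  rcases le_total U U₂ with hU' | hU'
  · exact hbox hU₁' hU'
  · have hU₂0 : (0 : ℝ) ≤ U₂ := hU₁.trans hU.le
    have hm : energyDensityTT' 1 t' U₂ n ≤ energyDensityTT' 1 t' U n :=
      energyDensityTT'_mono_U 1 t' (n := n) hn0 hn2 hU₂0 hU'
    exact (hbox hU.le le_rfl).trans hm

/-- **FLOOR device, SUB-RECTANGLE form with two-ended corner values (any slope sign).** As `cfxl_floor_sub_of`, but the four corner
values `F_v` are explicit and only required to lie below the corner tangent at BOTH ends of the filling slab; `L·den` is compared with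
the bilinear interpolant of the `F_v` at the four sub-rectangle corners. [cite: Israel1979, Thm. I.3.4] -/
theorem cfxl_floor_sub2_of {s₁ s₂ U₁ U₂ a₁₁ b₁₁ a₁₂ b₁₂ a₂₁ b₂₁ a₂₂ b₂₂ nlo nhi F₁₁ F₁₂ F₂₁ F₂₂ : ℝ}
    (hnlo : 0 ≤ nlo) (hnhi : nhi < 2) (hU₁ : 0 ≤ U₁) (hs : s₁ < s₂) (hU : U₁ < U₂)
    (hX₁₁ : ∀ n ∈ Set.Icc nlo nhi, a₁₁ + b₁₁ * n ≤ energyDensityTT' 1 s₁ U₁ n)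
    (hX₁₂ : ∀ n ∈ Set.Icc nlo nhi, a₁₂ + b₁₂ * n ≤ energyDensityTT' 1 s₁ U₂ n)
    (hX₂₁ : ∀ n ∈ Set.Icc nlo nhi, a₂₁ + b₂₁ * n ≤ energyDensityTT' 1 s₂ U₁ n)
    (hX₂₂ : ∀ n ∈ Set.Icc nlo nhi, a₂₂ + b₂₂ * n ≤ energyDensityTT' 1 s₂ U₂ n)
    (hF₁₁ : F₁₁ ≤ a₁₁ + b₁₁ * nlo) (hF₁₁' : F₁₁ ≤ a₁₁ + b₁₁ * nhi) (hF₁₂ : F₁₂ ≤ a₁₂ + b₁₂ * nlo) (hF₁₂' : F₁₂ ≤ a₁₂ + b₁₂ * nhi)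
    (hF₂₁ : F₂₁ ≤ a₂₁ + b₂₁ * nlo) (hF₂₁' : F₂₁ ≤ a₂₁ + b₂₁ * nhi) (hF₂₂ : F₂₂ ≤ a₂₂ + b₂₂ * nlo) (hF₂₂' : F₂₂ ≤ a₂₂ + b₂₂ * nhi)
    {σ₁ σ₂ V₁ V₂ L : ℝ} (hσ₁ : s₁ ≤ σ₁) (hσ : σ₁ < σ₂) (hσ₂ : σ₂ ≤ s₂) (hV₁ : U₁ ≤ V₁) (hV : V₁ < V₂) (hV₂ : V₂ ≤ U₂)
    (hP₁₁ : L * ((s₂ - s₁) * (U₂ - U₁)) ≤ (s₂ - σ₁) * ((U₂ - V₁) * F₁₁ + (V₁ - U₁) * F₁₂) + (σ₁ - s₁) * ((U₂ - V₁) * F₂₁ + (V₁ - U₁) * F₂₂))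
    (hP₁₂ : L * ((s₂ - s₁) * (U₂ - U₁)) ≤ (s₂ - σ₁) * ((U₂ - V₂) * F₁₁ + (V₂ - U₁) * F₁₂) + (σ₁ - s₁) * ((U₂ - V₂) * F₂₁ + (V₂ - U₁) * F₂₂))
    (hP₂₁ : L * ((s₂ - s₁) * (U₂ - U₁)) ≤ (s₂ - σ₂) * ((U₂ - V₁) * F₁₁ + (V₁ - U₁) * F₁₂) + (σ₂ - s₁) * ((U₂ - V₁) * F₂₁ + (V₁ - U₁) * F₂₂))
    (hP₂₂ : L * ((s₂ - s₁) * (U₂ - U₁)) ≤ (s₂ - σ₂) * ((U₂ - V₂) * F₁₁ + (V₂ - U₁) * F₁₂) + (σ₂ - s₁) * ((U₂ - V₂) * F₂₁ + (V₂ - U₁) * F₂₂))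
    {U t' n : ℝ} (hV₁' : V₁ ≤ U) (ht₁ : σ₁ ≤ t') (ht₂ : t' ≤ σ₂) (hn : n ∈ Set.Icc nlo nhi) :
    L ≤ energyDensityTT' 1 t' U n := by
  have hn0 : (0 : ℝ) ≤ n := hnlo.trans hn.1
  have hn2 : n < (2 : ℝ) := lt_of_le_of_lt hn.2 hnhi
  have hden : 0 < (s₂ - s₁) * (U₂ - U₁) := mul_pos (sub_pos.2 hs) (sub_pos.2 hU)
  have e₁₁ : F₁₁ ≤ energyDensityTT' 1 s₁ U₁ n := cfxl_tangent_ends hn.1 hn.2 (hX₁₁ n hn) hF₁₁ hF₁₁'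
  have e₁₂ : F₁₂ ≤ energyDensityTT' 1 s₁ U₂ n := cfxl_tangent_ends hn.1 hn.2 (hX₁₂ n hn) hF₁₂ hF₁₂'
  have e₂₁ : F₂₁ ≤ energyDensityTT' 1 s₂ U₁ n := cfxl_tangent_ends hn.1 hn.2 (hX₂₁ n hn) hF₂₁ hF₂₁'
  have e₂₂ : F₂₂ ≤ energyDensityTT' 1 s₂ U₂ n := cfxl_tangent_ends hn.1 hn.2 (hX₂₂ n hn) hF₂₂ hF₂₂'
  have pt : ∀ {σ V : ℝ}, s₁ ≤ σ → σ ≤ s₂ → U₁ ≤ V → V ≤ U₂ →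
      L * ((s₂ - s₁) * (U₂ - U₁)) ≤ (s₂ - σ) * ((U₂ - V) * F₁₁ + (V - U₁) * F₁₂) + (σ - s₁) * ((U₂ - V) * F₂₁ + (V - U₁) * F₂₂) →
      L ≤ energyDensityTT' 1 σ V n := by
    intro σ V h₁ h₂ h₃ h₄ hP
    have hb := energyDensityTT'_box_ge 1 (n := n) hn0 hn2 (s₁ := s₁) (s₂ := s₂) (U₁ := U₁) (U₂ := U₂) (s := σ) (U := V)
      hU₁ hs hU h₁ h₂ h₃ h₄ e₁₁ e₁₂ e₂₁ e₂₂
    have hL : L ≤ ((s₂ - σ) * ((U₂ - V) * F₁₁ + (V - U₁) * F₁₂) + (σ - s₁) * ((U₂ - V) * F₂₁ + (V - U₁) * F₂₂)) /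
        ((s₂ - s₁) * (U₂ - U₁)) := by
      rw [le_div_iff₀ hden]; exact hP
    exact hL.trans hb
  have c₁₁ := pt hσ₁ (hσ.le.trans hσ₂) hV₁ (hV.le.trans hV₂) hP₁₁
  have c₁₂ := pt hσ₁ (hσ.le.trans hσ₂) (hV₁.trans hV.le) hV₂ hP₁₂
  have c₂₁ := pt (hσ₁.trans hσ.le) hσ₂ hV₁ (hV.le.trans hV₂) hP₂₁
  have c₂₂ := pt (hσ₁.trans hσ.le) hσ₂ (hV₁.trans hV.le) hV₂ hP₂₂
  have hV₁0 : 0 ≤ V₁ := hU₁.trans hV₁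
  have hbox : ∀ {W : ℝ}, V₁ ≤ W → W ≤ V₂ → L ≤ energyDensityTT' 1 t' W n := by
    intro W hW₁ hW₂
    have hb := energyDensityTT'_box_ge_min 1 (n := n) hn0 hn2
      (s₁ := σ₁) (s₂ := σ₂) (U₁ := V₁) (U₂ := V₂) (s := t') (U := W)
      hV₁0 hσ hV ht₁ ht₂ hW₁ hW₂ c₁₁ c₁₂ c₂₁ c₂₂
    simpa only [min_self] using hb
  rcases le_total U V₂ with hU' | hU'
  · exact hbox hV₁' hU'
  · have hV₂0 : (0 : ℝ) ≤ V₂ := hV₁0.trans hV.le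
    have hm : energyDensityTT' 1 t' V₂ n ≤ energyDensityTT' 1 t' U n :=
      energyDensityTT'_mono_U 1 t' (n := n) hn0 hn2 hV₂0 hU'
    exact (hbox hV.le le_rfl).trans hm

/-- Affine endpoint bound: for `x ∈ [x₁, x₂]`, `α + β·x ≤ max (α + β·x₁) (α + β·x₂)` (any sign of `β`). [cite: Israel1979, Thm. I.3.4] -/
theorem cfxl_affine_le_max_ends {α β x x₁ x₂ : ℝ} (h₁ : x₁ ≤ x) (h₂ : x ≤ x₂) :
    α + β * x ≤ max (α + β * x₁) (α + β * x₂) := by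
  rcases le_total 0 β with hb | hb
  · have hm : β * x ≤ β * x₂ := mul_le_mul_of_nonneg_left h₂ hb
    exact le_max_of_le_right (by linarith)
  · have hm : β * x ≤ β * x₁ := mul_le_mul_of_nonpos_left h₁ hb
    exact le_max_of_le_left (by linarith)

/-- **CAP device, VARBOX plane of any design point on a `(t', U)` box.** A hubbard-fast VARBOX plane (REFEREED CAP PLANE, R6.68) of
filling `m`: `e₀(1,t',U,m) ≤ A + max(t'·B_lo, t'·B_hi) + U·D` for every real `t'` and every `U ≥ 0` (a fixed open-box state's energy is
affine in `(t',U)`; `B_lo ≤ B_hi` enclose the `t'`-coefficient, any sign); on the box `t' ∈ [tlo, thi]`, `0 ≤ U ≤ Uhi` (`D ≥ 0`) the plane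
is at most `S` whenever the four endpoint values `A + t_e·B_x + Uhi·D` (`t_e ∈ {tlo,thi}`, `B_x ∈ {B_lo,B_hi}`) are `≤ S`.
[cite: BachLiebSolovej1994, eq. (2c.36)] -/
theorem cfxl_plane_cap_of {m A Blo Bhi D : ℝ}
    (hP : ∀ (t' U : ℝ), 0 ≤ U → energyDensityTT' 1 t' U m ≤ A + max (t' * Blo) (t' * Bhi) + U * D)
    (hD : 0 ≤ D) {tlo thi Uhi S : ℝ}
    (hS₁ : A + tlo * Blo + Uhi * D ≤ S) (hS₂ : A + tlo * Bhi + Uhi * D ≤ S)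
    (hS₃ : A + thi * Blo + Uhi * D ≤ S) (hS₄ : A + thi * Bhi + Uhi * D ≤ S)
    {U t' : ℝ} (hU0 : 0 ≤ U) (hU₂ : U ≤ Uhi) (ht₁ : tlo ≤ t') (ht₂ : t' ≤ thi) :
    energyDensityTT' 1 t' U m ≤ S := by
  have h := hP t' U hU0
  have hDU : U * D ≤ Uhi * D := mul_le_mul_of_nonneg_right hU₂ hD
  have hlo : t' * Blo ≤ max (tlo * Blo) (thi * Blo) := by
    have := cfxl_affine_le_max_ends (α := 0) (β := Blo) ht₁ ht₂
    simpa only [zero_add, mul_comm] using this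
  have hhi : t' * Bhi ≤ max (tlo * Bhi) (thi * Bhi) := by
    have := cfxl_affine_le_max_ends (α := 0) (β := Bhi) ht₁ ht₂
    simpa only [zero_add, mul_comm] using this
  have hM : max (t' * Blo) (t' * Bhi) ≤ S - A - Uhi * D := by
    refine max_le (hlo.trans (max_le ?_ ?_)) (hhi.trans (max_le ?_ ?_)) <;> linarith
  linarith

/-- **CAP on a filling slab from two bracketing caps (density chord, endpoint form).** `e₀` is convex in the filling, so with caps
`e₀(m₁) ≤ c₁`, `e₀(m₂) ≤ c₂` (`0 ≤ m₁ < m₂ < 2`) every `n` in a slab `[nlo, nhi] ⊆ [m₁, m₂]` obeys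
`e₀(n) ≤ max (chord(nlo)) (chord(nhi))`, `chord(x) = ((m₂−x)c₁ + (x−m₁)c₂)/(m₂−m₁)`. [cite: Ruelle1969, §3.3] -/
theorem cfxl_cap_chord_of {m₁ m₂ c₁ c₂ nlo nhi : ℝ} (hm₁ : 0 ≤ m₁) (hm : m₁ < m₂) (hm₂ : m₂ < 2)
    (hlo : m₁ ≤ nlo) (hhi : nhi ≤ m₂)
    {U t' n : ℝ} (hU0 : 0 ≤ U) (h₁ : energyDensityTT' 1 t' U m₁ ≤ c₁) (h₂ : energyDensityTT' 1 t' U m₂ ≤ c₂)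
    (hn : n ∈ Set.Icc nlo nhi) :
    energyDensityTT' 1 t' U n ≤ max (((m₂ - nlo) * c₁ + (nlo - m₁) * c₂) / (m₂ - m₁))
      (((m₂ - nhi) * c₁ + (nhi - m₁) * c₂) / (m₂ - m₁)) := by
  have hd : 0 < m₂ - m₁ := sub_pos.2 hm
  have hc := energyDensityTT'_le_density_chord_of_mem_Icc 1 t' hU0 hm₁ hm hm₂ h₁ h₂ ⟨hlo.trans hn.1, hn.2.trans hhi⟩
  -- the chord value is affine in n: ((m₂ - n) c₁ + (n - m₁) c₂)/(m₂-m₁) = α + β n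
  have e : ∀ x : ℝ, ((m₂ - x) * c₁ + (x - m₁) * c₂) / (m₂ - m₁) =
      (m₂ * c₁ - m₁ * c₂) / (m₂ - m₁) + ((c₂ - c₁) / (m₂ - m₁)) * x := by
    intro x; field_simp; ring
  rw [e] at hc; rw [e nlo, e nhi]
  exact hc.trans (cfxl_affine_le_max_ends hn.1 hn.2)

/-- **Vacuum cap** `e₀(1,t',U,0) ≤ 0` packaged for `cfxl_cap_chord_of` with `m₁ = 0`, `c₁ = 0`. [cite: Ruelle1969, §3.3] -/
theorem cfxl_vacuum_cap (t' : ℝ) {U : ℝ} (hU0 : 0 ≤ U) : energyDensityTT' 1 t' U 0 ≤ 0 :=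
  energyDensityTT'_density_zero_le 1 t' hU0

end Summit.Ventures.CertifiedManyBodySolver.Certificates

end
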